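import Literature.NumberTheory.ModularForms.Lemma49Plus24G
import HarnessLib

/-!
# CKMRV Lemma 4.9 (4.15), (4.17) for `𝒦₋^{(24)}` (`γ ∈ {I, T, TS}`)

Cohn–Kumar–Miller–Radchenko–Viazovska, arXiv:1902.05438, Lemma 4.9 with `n_{−,τ} = 1`, `n_{−,z} = 1`,
`n̂_τ^{(24)} = 4`, `d = 24`: for `Im τ, Im z ≥ δ`,
(4.15) `|(𝒦₋^{(24)}|^τ_{12}γ|^z_{−10}S)(τ,z)| ≤ C|e^{πi(τ+z)}τ²z²/(Δ(τ)Δ(z)(j(τ)−j(z)))|`,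
(4.17) `|(𝒦₋^{(24)}|^z_{−10}S)(τ,z)| ≤ C|e^{πi(4τ+z)}τ²z²/(Δ(τ)Δ(z)(j(τ)−j(z)))|`.

With rows `(1, R₂, R₄)` (`R = ψ|γ`), `𝒦₋^{(24)}(τ,Sz)z^{10}Δ(τ)Δ(z)(j(τ)−j(z)) = c'·L_R` where
`L_R = F_V(τ)V(z) + F_{jV}(τ)·(jV)(z) + F_f(τ)·((E₁₀/Δ)(U²−W²))(z) + F_L(τ)·((E₁₄/Δ)𝓛_S)(z)`,
`F_V = 2𝔠ΔE₄³ − 3R₂E₁₀E₄³ + R₄E₈(3E₄³ − 𝔠Δ)`, `F_{jV} = 2Δ(−𝔠Δ + R₂E₁₀ − R₄E₈)`,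
`F_f = −Δ(R₂E₁₀ − R₄E₈)`, `F_L = −2𝔠Δ²` (`c' = 1/(2𝔠π)`, `𝔠 = 1728`). The `z`-functions have principal
parts `0, 16/b, 32/b, −16/b` (`b = e^{πiz}`), and `16F_{jV} + 32F_f − 16F_L = 0`, so
`L_R = F_V·V + F_{jV}(jV − 16/b) + F_f(f₋₂(U²−W²) − 32/b) + F_L(f₂𝓛_S + 16/b)` with every
`z`-factor `O(b)`. PROVED: (4.15) for rows with `R₂, R₄ = O(|τ|)`, `R₄E₄ − R₂E₆ = O(|τ|b)`
(`γ = I, T, TS`: `kernelMinus24_S_bound_415`), and (4.17) via the fourth-order expansion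
`ψ₄E₄ − ψ₂E₆ = 1152(πiτ + log 16 − 1)q + O(|τ|q²)` (`kernelMinus24_S_bound_417`).

## References

* H. Cohn, A. Kumar, S. D. Miller, D. Radchenko, M. Viazovska, Ann. of Math. 196 (2022),
  arXiv:1902.05438, §4.4 (4.13), Lemma 4.9 (4.15), (4.17). [CohnEtAl2019]
-/

noncomputable section

open Complex hiding I
open Filter Topology Asymptotics ModularForm SlashInvariantForm EisensteinSeries
open UpperHalfPlane hiding I
open Complex (I)
open scoped Real MatrixGroups ModularForm Manifold

namespace Literature.NumberTheory.ModularForms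

open Literature.NumberTheory.EllipticCurves.ModularForms (kleinJ kleinJ_smul continuous_kleinJ E₄_cube_eq_kleinJ_mul)

/-- `qhalf_ne_zero` (auxiliary). [cite: CohnEtAl2019, Lemma 4.9 (proof)] -/
theorem qhalf_ne_zero (τ : ℍ) : qhalf τ ≠ 0 := by unfold qhalf; exact Complex.exp_ne_zero _

/-! ## The row-parametrised kernel -/

/-- `𝒦₋^{(24)}` with rows `(1, R₂, R₄)` in place of `(ψ₀, ψ₂, ψ₄)`. [cite: CohnEtAl2019, §4.4 (4.13)] -/
def minus24Kernel (R2 R4 : ℍ → ℂ) (τ z : ℍ) : ℂ :=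
  1 / (2 * 1728 * (π : ℂ)) / (ModularForm.discriminant z * (kleinJ τ - kleinJ z)) *
    (ModularForm.discriminant τ *
        (-2 * 1728 * f2fun z * psiTilde0 z - 2 * 1728 * (kleinJ τ - kleinJ z) * psiTilde2 z) +
      R2 τ * E10fun τ * ((kleinJ τ + 2 * (kleinJ τ - kleinJ z)) * psiTilde2 z - fNeg2fun z * psiTilde4 z) +
      R4 τ * E8fun τ *
        ((1728 - 2 * (kleinJ τ - kleinJ z) - kleinJ τ) * psiTilde2 z + fNeg2fun z * psiTilde4 z))

/-- `kernelMinus24_eq_minus24Kernel` (auxiliary). [cite: CohnEtAl2019, Lemma 4.9 (proof)] -/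
theorem kernelMinus24_eq_minus24Kernel : kernelMinus24 = minus24Kernel psi2 psi4 := rfl

/-- Slashing in weight `12` acts on the rows (weights `2`, `4`). [cite: CohnEtAl2019, §4.4] -/
theorem minus24Kernel_slash (R2 R4 : ℍ → ℂ) (z : ℍ) (γ : SL(2, ℤ)) :
    (fun τ => minus24Kernel R2 R4 τ z) ∣[(12 : ℤ)] γ = fun τ => minus24Kernel (R2 ∣[(2 : ℤ)] γ) (R4 ∣[(4 : ℤ)] γ) τ z := by
  set c : ℂ := 1 / (2 * 1728 * (π : ℂ)) with hc
  set a₁ : ℍ → ℂ := ModularForm.discriminant * fun τ =>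
    c / (ModularForm.discriminant z * (kleinJ τ - kleinJ z)) *
      (-2 * 1728 * f2fun z * psiTilde0 z - 2 * 1728 * (kleinJ τ - kleinJ z) * psiTilde2 z) with ha₁
  set a₂ : ℍ → ℂ := E10fun * fun τ => c / (ModularForm.discriminant z * (kleinJ τ - kleinJ z)) *
    ((kleinJ τ + 2 * (kleinJ τ - kleinJ z)) * psiTilde2 z - fNeg2fun z * psiTilde4 z) with ha₂
  set a₃ : ℍ → ℂ := E8fun * fun τ => c / (ModularForm.discriminant z * (kleinJ τ - kleinJ z)) *
    ((1728 - 2 * (kleinJ τ - kleinJ z) - kleinJ τ) * psiTilde2 z + fNeg2fun z * psiTilde4 z) with ha₃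
  have h₁ : IsLevelOneInvariant 12 a₁ :=
    (isLevelOneInvariant_discriminant.mul (isLevelOneInvariant_comp_kleinJ fun j =>
      c / (ModularForm.discriminant z * (j - kleinJ z)) *
        (-2 * 1728 * f2fun z * psiTilde0 z - 2 * 1728 * (j - kleinJ z) * psiTilde2 z))).cast (by norm_num)
  have h₂ : IsLevelOneInvariant (12 - 2) a₂ :=
    (isLevelOneInvariant_E10.mul (isLevelOneInvariant_comp_kleinJ fun j =>
      c / (ModularForm.discriminant z * (j - kleinJ z)) *
        ((j + 2 * (j - kleinJ z)) * psiTilde2 z - fNeg2fun z * psiTilde4 z))).cast (by norm_num)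
  have h₃ : IsLevelOneInvariant (12 - 4) a₃ :=
    (isLevelOneInvariant_E8.mul (isLevelOneInvariant_comp_kleinJ fun j =>
      c / (ModularForm.discriminant z * (j - kleinJ z)) *
        ((1728 - 2 * (j - kleinJ z) - j) * psiTilde2 z + fNeg2fun z * psiTilde4 z))).cast (by norm_num)
  have key : ∀ (S2 S4 : ℍ → ℂ), (fun τ => minus24Kernel S2 S4 τ z) = a₁ + S2 * a₂ + S4 * a₃ := by
    intro S2 S4; funext τ
    simp only [minus24Kernel, ha₁, ha₂, ha₃, hc, Pi.add_apply, Pi.mul_apply]; ring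
  rw [key, key, SlashAction.add_slash, SlashAction.add_slash, h₁ γ, show (12 : ℤ) = 2 + (12 - 2) by norm_num,
    mul_slash_SL2, h₂ γ, show (2 : ℤ) + (12 - 2) = 4 + (12 - 4) by norm_num, mul_slash_SL2, h₃ γ]

/-! ## The multiplied-out `S`-twist -/

/-- The four `τ`-coefficient functions. [cite: CohnEtAl2019, Lemma 4.9 (proof)] -/
def FV24 (R2 R4 : ℍ → ℂ) (τ : ℍ) : ℂ :=
  2 * 1728 * ModularForm.discriminant τ * E₄ τ ^ 3 - 3 * R2 τ * E10fun τ * E₄ τ ^ 3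
    + R4 τ * E8fun τ * (3 * E₄ τ ^ 3 - 1728 * ModularForm.discriminant τ)
/-- `FjV24` (auxiliary). [cite: CohnEtAl2019, Lemma 4.9 (proof)] -/
def FjV24 (R2 R4 : ℍ → ℂ) (τ : ℍ) : ℂ :=
  2 * ModularForm.discriminant τ * (-1728 * ModularForm.discriminant τ + (R2 τ * E10fun τ - R4 τ * E8fun τ))
/-- `Ff24` (auxiliary). [cite: CohnEtAl2019, Lemma 4.9 (proof)] -/
def Ff24 (R2 R4 : ℍ → ℂ) (τ : ℍ) : ℂ := -(ModularForm.discriminant τ * (R2 τ * E10fun τ - R4 τ * E8fun τ))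
/-- `FL24` (auxiliary). [cite: CohnEtAl2019, Lemma 4.9 (proof)] -/
def FL24 (τ : ℍ) : ℂ := -2 * 1728 * ModularForm.discriminant τ ^ 2

/-- `L_R` with the `z`-side principal parts subtracted (they cancel: `16F_{jV} + 32F_f − 16F_L = 0`).
[cite: CohnEtAl2019, Lemma 4.9 (proof)] -/
def minus24SBracket (R2 R4 : ℍ → ℂ) (τ z : ℍ) : ℂ :=
  FV24 R2 R4 τ * thetaV z
  + FjV24 R2 R4 τ * (kleinJ z * thetaV z - 16 * (qhalf z)⁻¹)
  + Ff24 R2 R4 τ * (fNeg2fun z * (thetaU z ^ 2 - thetaW z ^ 2) - 32 * (qhalf z)⁻¹)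
  + FL24 τ * (f2fun z * logLambdaS z + 16 * (qhalf z)⁻¹)

/-- **The multiplied-out `S`-twist**: off the polar set,
`minus24Kernel R τ (Sz)·z^{10}·Δ(τ)Δ(z)(j(τ)−j(z)) = c'·L_R(τ,z)`, `c' = 1/(2·1728·π)`.
[cite: CohnEtAl2019, Lemma 4.9 (proof)] -/
theorem minus24Kernel_S_mul_eq (R2 R4 : ℍ → ℂ) (τ z : ℍ) (hJ : kleinJ τ - kleinJ z ≠ 0) :
    minus24Kernel R2 R4 τ (ModularGroup.S • z) * (z : ℂ) ^ 10 *
      (ModularForm.discriminant τ * ModularForm.discriminant z * (kleinJ τ - kleinJ z)) =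
        1 / (2 * 1728 * (π : ℂ)) * minus24SBracket R2 R4 τ z := by
  have hz : (z : ℂ) ≠ 0 := z.ne_zero
  have hΔz := ModularForm.discriminant_ne_zero z
  have hΔτ := ModularForm.discriminant_ne_zero τ
  have hπ : (π : ℂ) ≠ 0 := ofReal_ne_zero.2 Real.pi_ne_zero
  have hb := qhalf_ne_zero z
  obtain ⟨hU, hV, hW⟩ := thetaUVW_S_smul z
  have hjτ : kleinJ τ * ModularForm.discriminant τ = E₄ τ ^ 3 := (E₄_cube_eq_kleinJ_mul τ).symm
  simp only [minus24Kernel, minus24SBracket, FV24, FjV24, Ff24, FL24, kleinJ_smul, discriminant_S_smul', psiTilde0, psiTilde2,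
    psiTilde4, logLambda_S_smul, E8fun, E10fun, E14fun, f2fun, fNeg2fun, Pi.mul_apply, Pi.sub_apply, Pi.inv_apply,
    E₄_S_smul, E₆_S_smul, hU, hV, hW]
  field_simp
  have e1 : kleinJ τ = E₄ τ ^ 3 / ModularForm.discriminant τ := by rw [eq_div_iff hΔτ]; exact hjτ
  rw [e1]
  field_simp
  ring

/-- `norm_minus24Kernel_S_mul_le` (auxiliary). [cite: CohnEtAl2019, Lemma 4.9 (proof)] -/
theorem norm_minus24Kernel_S_mul_le (R2 R4 : ℍ → ℂ) (τ z : ℍ) :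
    ‖minus24Kernel R2 R4 τ (ModularGroup.S • z) * (z : ℂ) ^ 10 *
      (ModularForm.discriminant τ * ModularForm.discriminant z * (kleinJ τ - kleinJ z))‖
        ≤ ‖1 / (2 * 1728 * (π : ℂ))‖ * ‖minus24SBracket R2 R4 τ z‖ := by
  by_cases hJ : kleinJ τ - kleinJ z = 0
  · rw [hJ]; simp
  · rw [minus24Kernel_S_mul_eq R2 R4 τ z hJ, norm_mul]

/-! ## The `z`-side functions are `O(e^{−π Im z})` -/

/-- If `q^{k/2}F = O(q^{(m+k)/2})` at `i∞` then `F = O(q^{m/2})`. [folklore] -/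
theorem isBigO_of_qhalf_pow_mul {F : ℍ → ℂ} {m k : ℕ}
    (h : (fun τ => qhalf τ ^ k * F τ) =O[atImInfty] fun τ => expDecayHalf τ ^ (m + k)) :
    F =O[atImInfty] fun τ => expDecayHalf τ ^ m := by
  obtain ⟨C, hC⟩ := h.bound
  refine IsBigO.of_bound C (hC.mono fun τ hτ => ?_)
  have hq : 0 < expDecayHalf τ := expDecayHalf_pos τ
  rw [norm_mul, norm_pow, norm_qhalf, Real.norm_of_nonneg (pow_nonneg hq.le _), pow_add,
    mul_comm (expDecayHalf τ ^ m), ← mul_assoc] at hτ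
  rw [Real.norm_of_nonneg (pow_nonneg hq.le _)]
  exact le_of_mul_le_mul_left (by linarith [hτ]) (pow_pos hq k)

/-- At `i∞`: `jV − 16/b`, `(E₁₀/Δ)(U² − W²) − 32/b`, `(E₁₄/Δ)𝓛_S + 16/b` are `O(b)` (`b = e^{πiz}`).
[cite: CohnEtAl2019, §2.1, Lemma 4.9 (proof)] -/
theorem minus24_z_isBigO_atImInfty :
    ((fun z : ℍ => kleinJ z * thetaV z - 16 * (qhalf z)⁻¹) =O[atImInfty] expDecayHalf) ∧
    ((fun z : ℍ => fNeg2fun z * (thetaU z ^ 2 - thetaW z ^ 2) - 32 * (qhalf z)⁻¹) =O[atImInfty] expDecayHalf) ∧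
    ((fun z : ℍ => f2fun z * logLambdaS z + 16 * (qhalf z)⁻¹) =O[atImInfty] expDecayHalf) := by
  have hb : (fun τ => qhalf τ) =O[atImInfty] expDecayHalf := qhalf_isBigO
  have hb1 : (fun τ => qhalf τ) =O[atImInfty] fun _ : ℍ => (1 : ℝ) := qhalf_isBigO_one
  have hU := thetaU_fourth_order
  have hW := thetaW_fourth_order
  have hV := thetaV_fourth_order
  have hS := logLambdaS_third_order
  have pw := fun {m n : ℕ} (h : n ≤ m) => expDecayHalf_pow_isBigO_pow (m := m) (n := n) h
  have one1 : (fun _ : ℍ => (1 : ℂ)) =O[atImInfty] fun _ : ℍ => (1 : ℝ) := isBigO_const_const (1 : ℂ) (one_ne_zero : (1:ℝ) ≠ 0) _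
  have e2 : ∀ τ : ℍ, expDecay τ ^ 2 = expDecayHalf τ ^ 4 := fun τ => by rw [expDecay_eq_sq]; ring
  have hj : (fun τ : ℍ => qfun τ * kleinJ τ - 1 - 744 * qfun τ) =O[atImInfty] fun τ => expDecayHalf τ ^ 4 :=
    kleinJ_mul_q_second_order.congr_right fun τ => e2 τ
  have hf2 : (fun τ : ℍ => qfun τ * f2fun τ - 1) =O[atImInfty] fun τ => expDecayHalf τ ^ 4 :=
    qfun_mul_f2fun_second_order.congr_right fun τ => e2 τ
  have hfm : (fun τ : ℍ => qfun τ * fNeg2fun τ - 1 + 240 * qfun τ) =O[atImInfty] fun τ => expDecayHalf τ ^ 4 :=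
    qfun_mul_fNeg2fun_second_order.congr_right fun τ => e2 τ
  have hq1 : (fun τ : ℍ => qfun τ) =O[atImInfty] fun _ : ℍ => (1 : ℝ) := qfun_isBigO_one
  have hq2 : (fun τ : ℍ => qfun τ) =O[atImInfty] fun τ => expDecayHalf τ ^ 2 :=
    (hb.pow 2).congr_left fun τ => qhalf_sq τ
  -- powers of `b`
  have hbp : ∀ n : ℕ, (fun τ : ℍ => qhalf τ ^ n) =O[atImInfty] fun τ => expDecayHalf τ ^ n := fun n => hb.pow n
  have hbp1 : ∀ n : ℕ, (fun τ : ℍ => qhalf τ ^ n) =O[atImInfty] fun _ : ℍ => (1 : ℝ) := fun n =>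
    ((hbp n).trans (pw (Nat.zero_le n))).congr_right fun τ => pow_zero _
  have hV1 : thetaV =O[atImInfty] fun _ : ℍ => (1 : ℝ) := tendsto_thetaV.isBigO_one ℝ
  have hU1 : thetaU =O[atImInfty] fun _ : ℍ => (1 : ℝ) := tendsto_thetaU.isBigO_one ℝ
  have hW1 : thetaW =O[atImInfty] fun _ : ℍ => (1 : ℝ) := tendsto_thetaW.isBigO_one ℝ
  have fin : ∀ {s : ℍ → ℂ}, (fun z => qhalf z ^ 3 * s z) =O[atImInfty] (fun z => expDecayHalf z ^ 4) → s =O[atImInfty] expDecayHalf :=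
    fun h => (isBigO_of_qhalf_pow_mul (m := 1) (k := 3) h).congr_right fun z => pow_one _
  refine ⟨fin ?_, fin ?_, fin ?_⟩
  · -- `b³(jV − 16/b) = (qj − 1 − 744q)(bV) + (1 + 744q)·b(V − 16b − 64b³) + (64 + 744·16)b⁴ + 744·64 b⁶`
    have t1 : (fun τ : ℍ => (qfun τ * kleinJ τ - 1 - 744 * qfun τ) * (qhalf τ * thetaV τ)) =O[atImInfty]
        fun τ => expDecayHalf τ ^ 4 := by
      have hbV : (fun τ => qhalf τ * thetaV τ) =O[atImInfty] fun _ : ℍ => (1 : ℝ) := by simpa using hb1.mul hV1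
      simpa using hj.mul hbV
    have t2 : (fun τ : ℍ => (1 + 744 * qfun τ) * (qhalf τ * (thetaV τ - 16 * qhalf τ - 64 * qhalf τ ^ 3))) =O[atImInfty]
        fun τ => expDecayHalf τ ^ 4 := by
      have hbd : (fun τ : ℍ => 1 + 744 * qfun τ) =O[atImInfty] fun _ : ℍ => (1 : ℝ) := one1.add (hq1.const_mul_left 744)
      have := hbd.mul (hb.mul (hV.trans (pw (by norm_num : 3 ≤ 5))))
      exact this.congr_right fun τ => by ring
    have t3 : (fun τ : ℍ => (64 + 744 * 16) * qhalf τ ^ 4 + 744 * 64 * qhalf τ ^ 6) =O[atImInfty] fun τ => expDecayHalf τ ^ 4 :=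
      ((hbp 4).const_mul_left _).add (((hbp 6).trans (pw (by norm_num : 4 ≤ 6))).const_mul_left _)
    have := (t1.add t2).add t3
    refine this.congr_left fun τ => ?_
    have hbz := qhalf_ne_zero τ
    have hsq := qhalf_sq τ
    field_simp
    rw [← hsq]
    ring
  · -- `P := b(U−W)(U+W) − 32b² = O(b⁴)`
    have hUW : (fun τ : ℍ => thetaU τ - thetaW τ - 16 * qhalf τ - 64 * qhalf τ ^ 3) =O[atImInfty] fun τ => expDecayHalf τ ^ 4 :=
      (hU.sub hW).congr_left fun τ => by ring
    have hUpW : (fun τ : ℍ => thetaU τ + thetaW τ - 2 - 48 * qhalf τ ^ 2) =O[atImInfty] fun τ => expDecayHalf τ ^ 4 :=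
      (hU.add hW).congr_left fun τ => by ring
    have hUpW1 : (fun τ : ℍ => thetaU τ + thetaW τ) =O[atImInfty] fun _ : ℍ => (1 : ℝ) := hU1.add hW1
    have hP : (fun τ : ℍ => qhalf τ * ((thetaU τ - thetaW τ) * (thetaU τ + thetaW τ)) - 32 * qhalf τ ^ 2) =O[atImInfty]
        fun τ => expDecayHalf τ ^ 4 := by
      have a1 : (fun τ : ℍ => qhalf τ * ((thetaU τ - thetaW τ - 16 * qhalf τ - 64 * qhalf τ ^ 3) * (thetaU τ + thetaW τ))) =O[atImInfty]
          fun τ => expDecayHalf τ ^ 4 := by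
        have := hb1.mul (hUW.mul hUpW1)
        exact this.congr_right fun τ => by ring
      have a2 : (fun τ : ℍ => qhalf τ * ((16 * qhalf τ + 64 * qhalf τ ^ 3) * (thetaU τ + thetaW τ - 2 - 48 * qhalf τ ^ 2))) =O[atImInfty]
          fun τ => expDecayHalf τ ^ 4 := by
        have hb16 : (fun τ : ℍ => 16 * qhalf τ + 64 * qhalf τ ^ 3) =O[atImInfty] fun _ : ℍ => (1 : ℝ) :=
          (hb1.const_mul_left 16).add ((hbp1 3).const_mul_left 64)
        have := hb1.mul (hb16.mul hUpW)
        exact this.congr_right fun τ => by ring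
      have a3 : (fun τ : ℍ => (128 + 768) * qhalf τ ^ 4 + 64 * 48 * qhalf τ ^ 6) =O[atImInfty] fun τ => expDecayHalf τ ^ 4 :=
        ((hbp 4).const_mul_left _).add (((hbp 6).trans (pw (by norm_num : 4 ≤ 6))).const_mul_left _)
      exact ((a1.add a2).add a3).congr_left fun τ => by ring
    have hbd : (fun τ : ℍ => qhalf τ * ((thetaU τ - thetaW τ) * (thetaU τ + thetaW τ))) =O[atImInfty] fun _ : ℍ => (1 : ℝ) := by
      have := hb1.mul ((hU1.sub hW1).mul hUpW1)
      exact this.congr_right fun τ => by ring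
    have t1 : (fun τ : ℍ => (qfun τ * fNeg2fun τ - 1 + 240 * qfun τ) * (qhalf τ * ((thetaU τ - thetaW τ) * (thetaU τ + thetaW τ))))
        =O[atImInfty] fun τ => expDecayHalf τ ^ 4 := by
      have := hfm.mul hbd
      exact this.congr_right fun τ => by ring
    -- `240 q · b(U−W)(U+W) = 240 q (P + 32 b²) = O(b⁴)`
    have t2 : (fun τ : ℍ => 240 * qfun τ * (qhalf τ * ((thetaU τ - thetaW τ) * (thetaU τ + thetaW τ)))) =O[atImInfty]
        fun τ => expDecayHalf τ ^ 4 := by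
      have hP1 : (fun τ : ℍ => qhalf τ * ((thetaU τ - thetaW τ) * (thetaU τ + thetaW τ))) =O[atImInfty] fun τ => expDecayHalf τ ^ 2 := by
        have := (hP.trans (pw (by norm_num : 2 ≤ 4))).add ((hbp 2).const_mul_left 32)
        exact this.congr_left fun τ => by ring
      have := (hq2.mul hP1).const_mul_left 240
      exact this.congr (fun τ => by ring) (fun τ => by ring)
    have := (t1.sub t2).add hP
    refine this.congr_left fun τ => ?_
    have hbz := qhalf_ne_zero τ
    have hsq := qhalf_sq τ
    field_simp
    rw [← hsq]
    ring
  · -- `b³(f₂𝓛_S + 16/b) = (qf₂ − 1)(b𝓛_S) + b(𝓛_S + 16b)`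
    have hS1 : logLambdaS =O[atImInfty] fun _ : ℍ => (1 : ℝ) := by
      have t : logLambdaS =O[atImInfty] expDecayHalf := by
        have := ((hS.trans (pw (by norm_num : 1 ≤ 3))).congr_right fun τ => pow_one _).sub (hb.const_mul_left 16)
        exact this.congr_left fun τ => by ring
      exact t.trans ((pw (Nat.zero_le 1)).congr (fun τ => pow_one _) (fun τ => pow_zero _))
    have t1 : (fun τ : ℍ => (qfun τ * f2fun τ - 1) * (qhalf τ * logLambdaS τ)) =O[atImInfty] fun τ => expDecayHalf τ ^ 4 := by
      have hbd : (fun τ => qhalf τ * logLambdaS τ) =O[atImInfty] fun _ : ℍ => (1 : ℝ) := by simpa using hb1.mul hS1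
      simpa using hf2.mul hbd
    have t2 : (fun τ : ℍ => qhalf τ * (logLambdaS τ + 16 * qhalf τ)) =O[atImInfty] fun τ => expDecayHalf τ ^ 4 := by
      have := hb.mul hS
      exact this.congr_right fun τ => by ring
    have := t1.add t2
    refine this.congr_left fun τ => ?_
    have hbz := qhalf_ne_zero τ
    have hsq := qhalf_sq τ
    field_simp
    rw [← hsq]
    ring

/-- `continuous_qhalf_inv` (auxiliary). [cite: CohnEtAl2019, Lemma 4.9 (proof)] -/
@[fun_prop] theorem continuous_qhalf_inv : Continuous fun z : ℍ => (qhalf z)⁻¹ :=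
  Continuous.inv₀ continuous_qhalf qhalf_ne_zero

/-- The same `z`-side facts on half-planes (together with `V = O(b)`). [cite: CohnEtAl2019, Lemma 4.9 (proof)] -/
theorem minus24_z_isBigO_halfPlane {δ : ℝ} (hδ : 0 < δ) :
    (thetaV =O[𝓟 (halfPlane δ)] expDecayHalf) ∧
    ((fun z : ℍ => kleinJ z * thetaV z - 16 * (qhalf z)⁻¹) =O[𝓟 (halfPlane δ)] expDecayHalf) ∧
    ((fun z : ℍ => fNeg2fun z * (thetaU z ^ 2 - thetaW z ^ 2) - 32 * (qhalf z)⁻¹) =O[𝓟 (halfPlane δ)] expDecayHalf) ∧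
    ((fun z : ℍ => f2fun z * logLambdaS z + 16 * (qhalf z)⁻¹) =O[𝓟 (halfPlane δ)] expDecayHalf) := by
  obtain ⟨_, _, hVb, _⟩ := halfPlane_isBigO_theta hδ
  obtain ⟨a1, a2, a3⟩ := minus24_z_isBigO_atImInfty
  have conv : ∀ {G : ℍ → ℂ}, Continuous G → (∀ τ : ℍ, G ((2 : ℝ) +ᵥ τ) = G τ) → G =O[atImInfty] expDecayHalf →
      G =O[𝓟 (halfPlane δ)] expDecayHalf := by
    intro G hc hp hO
    have := isBigO_halfPlane_of_two_periodic_half hc hp 1 (hO.congr_right fun τ => (pow_one _).symm) hδ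
    exact this.congr_right fun τ => pow_one _
  have pj := kleinJ_vadd_two; have pf := f2fun_vadd_two; have pfm := fNeg2fun_vadd_two; have pS := logLambdaS_vadd_two
  have pq : ∀ τ : ℍ, (qhalf ((2 : ℝ) +ᵥ τ))⁻¹ = (qhalf τ)⁻¹ := fun τ => by rw [qhalf_vadd_two]
  have pU := fun τ => (thetaUVW_vadd_two τ).1
  have pV := fun τ => (thetaUVW_vadd_two τ).2.1
  have pW := fun τ => (thetaUVW_vadd_two τ).2.2
  refine ⟨hVb, conv (by fun_prop) (fun τ => by simp only [pj, pV, pq]) a1,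
    conv (by fun_prop) (fun τ => by simp only [pfm, pU, pW, pq]) a2, conv (by fun_prop) (fun τ => by simp only [pf, pS, pq]) a3⟩

/-! ## The master bound -/

/-- **Master bound**: if `F_V, F_{jV}, F_f = O(|τ|b^k)` (`k ≤ 4`) on `Im τ ≥ δ` then
`L_R = O(|τ| b_τ^k b_z)` on the product of half-planes. [cite: CohnEtAl2019, Lemma 4.9 (proof)] -/
theorem minus24SBracket_isBigO {δ : ℝ} (hδ : 0 < δ) {R2 R4 : ℍ → ℂ} {k : ℕ} (hk : k ≤ 4)
    (hV : FV24 R2 R4 =O[𝓟 (halfPlane δ)] fun τ : ℍ => ‖(τ : ℂ)‖ * expDecayHalf τ ^ k)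
    (hjV : FjV24 R2 R4 =O[𝓟 (halfPlane δ)] fun τ : ℍ => ‖(τ : ℂ)‖ * expDecayHalf τ ^ k)
    (hf : Ff24 R2 R4 =O[𝓟 (halfPlane δ)] fun τ : ℍ => ‖(τ : ℂ)‖ * expDecayHalf τ ^ k) :
    (fun p : ℍ × ℍ => minus24SBracket R2 R4 p.1 p.2) =O[𝓟 (halfPlane δ ×ˢ halfPlane δ)]
      fun p => ‖(p.1 : ℂ)‖ * expDecayHalf p.1 ^ k * expDecayHalf p.2 := by
  obtain ⟨gV, g1, g2, g3⟩ := minus24_z_isBigO_halfPlane hδ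
  obtain ⟨_, _, _, hΔ, _, _, _, h1, _, _⟩ := halfPlane_isBigO_basic hδ
  set F := 𝓟 (halfPlane δ ×ˢ halfPlane δ)
  have hb0 : ∀ τ : ℍ, 0 ≤ expDecayHalf τ := fun τ => (expDecayHalf_pos τ).le
  -- `F_L = −3456Δ² = O(b⁴) ⊂ O(|τ|b^k)`
  have hΔb2 : (ModularForm.discriminant : ℍ → ℂ) =O[𝓟 (halfPlane δ)] fun τ => expDecayHalf τ ^ 2 :=
    hΔ.congr_right fun τ => expDecay_eq_sq τ
  have hL : FL24 =O[𝓟 (halfPlane δ)] fun τ : ℍ => ‖(τ : ℂ)‖ * expDecayHalf τ ^ k := by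
    have t : (fun τ : ℍ => ModularForm.discriminant τ ^ 2) =O[𝓟 (halfPlane δ)] fun τ => expDecayHalf τ ^ 4 := by
      have := hΔb2.mul hΔb2; exact this.congr (fun τ => by ring) (fun τ => by ring)
    have t4k : (fun τ : ℍ => expDecayHalf τ ^ 4) =O[𝓟 (halfPlane δ)] fun τ => expDecayHalf τ ^ k := by
      rw [isBigO_principal]; exact ⟨1, fun τ _ => by
        rw [Real.norm_of_nonneg (pow_nonneg (hb0 τ) _), Real.norm_of_nonneg (pow_nonneg (hb0 τ) _), one_mul]
        exact pow_le_pow_of_le_one (hb0 τ) (expDecayHalf_le_one τ) hk⟩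
    have := h1.mul ((t.trans t4k).const_mul_left (-2 * 1728))
    exact this.congr (fun τ => by simp only [FL24]; ring) (fun τ => by ring)
  have T : ∀ {a c : ℍ → ℂ}, a =O[𝓟 (halfPlane δ)] (fun τ : ℍ => ‖(τ : ℂ)‖ * expDecayHalf τ ^ k) →
      c =O[𝓟 (halfPlane δ)] expDecayHalf →
      (fun p : ℍ × ℍ => a p.1 * c p.2) =O[F] fun p => ‖(p.1 : ℂ)‖ * expDecayHalf p.1 ^ k * expDecayHalf p.2 :=
    fun ha hc => (isBigO_fst_of_halfPlane ha).mul (isBigO_snd_of_halfPlane hc)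
  have total := (((T hV gV).add (T hjV g1)).add (T hf g2)).add (T hL g3)
  refine total.congr_left fun p => ?_
  simp only [minus24SBracket]

/-- Conversion to the printed shape. [folklore] -/
theorem minus24Kernel_S_bound_of_isBigO {δ : ℝ} (hδ : 0 < δ) {R2 R4 : ℍ → ℂ} {k : ℕ}
    (hO : (fun p : ℍ × ℍ => minus24SBracket R2 R4 p.1 p.2) =O[𝓟 (halfPlane δ ×ˢ halfPlane δ)]
      fun p => ‖(p.1 : ℂ)‖ * expDecayHalf p.1 ^ k * expDecayHalf p.2) :
    ∃ C : ℝ, ∀ τ z : ℍ, δ ≤ τ.im → δ ≤ z.im →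
      ‖minus24Kernel R2 R4 τ (ModularGroup.S • z) * (z : ℂ) ^ 10 *
        (ModularForm.discriminant τ * ModularForm.discriminant z * (kleinJ τ - kleinJ z))‖
          ≤ C * (‖(τ : ℂ)‖ ^ 2 * ‖(z : ℂ)‖ ^ 2 * expDecayHalf τ ^ k * expDecayHalf z) := by
  obtain ⟨C, hC⟩ := isBigO_principal.1 hO
  set c₀ : ℝ := ‖1 / (2 * 1728 * (π : ℂ))‖
  refine ⟨c₀ * |C| / δ ^ 3, fun τ z hτ hz => (norm_minus24Kernel_S_mul_le R2 R4 τ z).trans ?_⟩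
  have h := hC (τ, z) ⟨hτ, hz⟩
  have hb0 : ∀ σ : ℍ, 0 ≤ expDecayHalf σ := fun σ => (expDecayHalf_pos σ).le
  have hX0 : 0 ≤ ‖(τ : ℂ)‖ * expDecayHalf τ ^ k * expDecayHalf z :=
    mul_nonneg (mul_nonneg (norm_nonneg _) (pow_nonneg (hb0 τ) k)) (hb0 z)
  rw [Real.norm_of_nonneg hX0] at h
  have hτ1 : δ ≤ ‖(τ : ℂ)‖ := hτ.trans (im_le_norm_coe τ)
  have hz1 : δ ≤ ‖(z : ℂ)‖ := hz.trans (im_le_norm_coe z)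
  have h2 : ‖minus24SBracket R2 R4 τ z‖ ≤ |C| * (‖(τ : ℂ)‖ * expDecayHalf τ ^ k * expDecayHalf z) :=
    h.trans (mul_le_mul_of_nonneg_right (le_abs_self C) hX0)
  have h3 : |C| * (‖(τ : ℂ)‖ * expDecayHalf τ ^ k * expDecayHalf z) ≤
      |C| / δ ^ 3 * (‖(τ : ℂ)‖ ^ 2 * ‖(z : ℂ)‖ ^ 2 * expDecayHalf τ ^ k * expDecayHalf z) := by
    rw [show |C| / δ ^ 3 * (‖(τ : ℂ)‖ ^ 2 * ‖(z : ℂ)‖ ^ 2 * expDecayHalf τ ^ k * expDecayHalf z) =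
      |C| * (‖(τ : ℂ)‖ * expDecayHalf τ ^ k * expDecayHalf z) * ((‖(τ : ℂ)‖ / δ) * (‖(z : ℂ)‖ / δ) ^ 2) by field_simp]
    refine le_mul_of_one_le_right (mul_nonneg (abs_nonneg C) hX0) ?_
    have a : 1 ≤ ‖(τ : ℂ)‖ / δ := by rw [le_div_iff₀ hδ]; linarith
    have b : 1 ≤ ‖(z : ℂ)‖ / δ := by rw [le_div_iff₀ hδ]; linarith
    nlinarith [one_le_pow₀ (n := 2) b]
  calc c₀ * ‖minus24SBracket R2 R4 τ z‖ ≤ c₀ * (|C| / δ ^ 3 * (‖(τ : ℂ)‖ ^ 2 * ‖(z : ℂ)‖ ^ 2 * expDecayHalf τ ^ k * expDecayHalf z)) :=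
        mul_le_mul_of_nonneg_left (h2.trans h3) (norm_nonneg _)
    _ = _ := by ring

/-! ## (4.15): rows with `R₂, R₄ = O(|τ|)` and `R₄E₄ − R₂E₆ = O(|τ|b)` -/

/-- `FV24_eq` (auxiliary). [cite: CohnEtAl2019, Lemma 4.9 (proof)] -/
theorem FV24_eq (R2 R4 : ℍ → ℂ) (τ : ℍ) : FV24 R2 R4 τ =
    3 * E₄ τ ^ 4 * (R4 τ * E₄ τ - R2 τ * E₆ τ) + 1728 * ModularForm.discriminant τ * E₄ τ ^ 2 * (2 * E₄ τ - R4 τ) := by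
  simp only [FV24, E10fun, E8fun, Pi.mul_apply]; ring

/-- The `τ`-coefficients for rows with `R₂, R₄ = O(|τ|)`, `R₄E₄ − R₂E₆ = O(|τ|b)` are `O(|τ|b)`.
[cite: CohnEtAl2019, Lemma 4.9 (proof)] -/
theorem minus24_F_isBigO_of_rows {δ : ℝ} (hδ : 0 < δ) {R2 R4 : ℍ → ℂ}
    (h2 : R2 =O[𝓟 (halfPlane δ)] fun τ : ℍ => ‖(τ : ℂ)‖) (h4 : R4 =O[𝓟 (halfPlane δ)] fun τ : ℍ => ‖(τ : ℂ)‖)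
    (hd : (fun τ => R4 τ * E₄ τ - R2 τ * E₆ τ) =O[𝓟 (halfPlane δ)] fun τ : ℍ => ‖(τ : ℂ)‖ * expDecayHalf τ ^ 1) :
    (FV24 R2 R4 =O[𝓟 (halfPlane δ)] fun τ : ℍ => ‖(τ : ℂ)‖ * expDecayHalf τ ^ 1) ∧
    (FjV24 R2 R4 =O[𝓟 (halfPlane δ)] fun τ : ℍ => ‖(τ : ℂ)‖ * expDecayHalf τ ^ 1) ∧
    (Ff24 R2 R4 =O[𝓟 (halfPlane δ)] fun τ : ℍ => ‖(τ : ℂ)‖ * expDecayHalf τ ^ 1) := by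
  obtain ⟨_, _, _, hΔ, hE4, hE6, _, h1, hcoe, hq1⟩ := halfPlane_isBigO_basic hδ
  set l := 𝓟 (halfPlane δ)
  have hb0 : ∀ τ : ℍ, 0 ≤ expDecayHalf τ := fun τ => (expDecayHalf_pos τ).le
  have bb : ∀ {u v : ℍ → ℂ}, u =O[l] (fun _ : ℍ => (1 : ℝ)) → v =O[l] (fun _ : ℍ => (1 : ℝ)) →
      (fun τ => u τ * v τ) =O[l] fun _ : ℍ => (1 : ℝ) := fun hu hv => by simpa using hu.mul hv
  have hE4_2 : (fun τ : ℍ => E₄ τ ^ 2) =O[l] fun _ : ℍ => (1 : ℝ) := by simpa [sq] using bb hE4 hE4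
  have hE4_4 : (fun τ : ℍ => E₄ τ ^ 4) =O[l] fun _ : ℍ => (1 : ℝ) := by simpa [← pow_add] using bb hE4_2 hE4_2
  -- `Δ = O(b²) ⊂ O(b)`
  have hΔb : (ModularForm.discriminant : ℍ → ℂ) =O[l] fun τ => expDecayHalf τ ^ 1 := by
    refine (hΔ.congr_right fun τ => expDecay_eq_sq τ).trans ?_
    rw [isBigO_principal]; exact ⟨1, fun τ _ => by
      rw [Real.norm_of_nonneg (pow_nonneg (hb0 τ) _), Real.norm_of_nonneg (pow_nonneg (hb0 τ) _), one_mul]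
      exact pow_le_pow_of_le_one (hb0 τ) (expDecayHalf_le_one τ) (by norm_num)⟩
  have hΔ1 : (ModularForm.discriminant : ℍ → ℂ) =O[l] fun _ : ℍ => (1 : ℝ) := hΔ.trans hq1
  -- `X_R = R₂E₁₀ − R₄E₈ = O(|τ|)`, `2E₄ − R₄ = O(|τ|)`
  have hX : (fun τ => R2 τ * E10fun τ - R4 τ * E8fun τ) =O[l] fun τ : ℍ => ‖(τ : ℂ)‖ := by
    have t1 : (fun τ => R2 τ * E10fun τ) =O[l] fun τ : ℍ => ‖(τ : ℂ)‖ := by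
      simpa using h2.mul ((bb hE4 hE6).congr_left fun τ => by simp [E10fun])
    have t2 : (fun τ => R4 τ * E8fun τ) =O[l] fun τ : ℍ => ‖(τ : ℂ)‖ := by
      simpa using h4.mul ((bb hE4 hE4).congr_left fun τ => by simp [E8fun])
    exact t1.sub t2
  have hY : (fun τ => 2 * E₄ τ - R4 τ) =O[l] fun τ : ℍ => ‖(τ : ℂ)‖ := by
    have t1 : (fun τ : ℍ => 2 * E₄ τ) =O[l] fun τ : ℍ => ‖(τ : ℂ)‖ := by simpa using (h1.mul hE4).const_mul_left 2
    exact t1.sub h4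
  refine ⟨?_, ?_, ?_⟩
  · rw [show FV24 R2 R4 = fun τ => 3 * E₄ τ ^ 4 * (R4 τ * E₄ τ - R2 τ * E₆ τ) +
        1728 * ModularForm.discriminant τ * E₄ τ ^ 2 * (2 * E₄ τ - R4 τ) from funext (FV24_eq R2 R4)]
    have t1 : (fun τ => 3 * E₄ τ ^ 4 * (R4 τ * E₄ τ - R2 τ * E₆ τ)) =O[l] fun τ : ℍ => ‖(τ : ℂ)‖ * expDecayHalf τ ^ 1 := by
      have := (hE4_4.mul hd).const_mul_left 3
      exact this.congr (fun τ => by ring) (fun τ => by ring)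
    have t2 : (fun τ => 1728 * ModularForm.discriminant τ * E₄ τ ^ 2 * (2 * E₄ τ - R4 τ)) =O[l]
        fun τ : ℍ => ‖(τ : ℂ)‖ * expDecayHalf τ ^ 1 := by
      have := ((hΔb.mul hE4_2).mul hY).const_mul_left 1728
      exact this.congr (fun τ => by ring) (fun τ => by ring)
    exact t1.add t2
  · have t : (fun τ => -1728 * ModularForm.discriminant τ + (R2 τ * E10fun τ - R4 τ * E8fun τ)) =O[l] fun τ : ℍ => ‖(τ : ℂ)‖ := by
      have t1 : (fun τ : ℍ => -1728 * ModularForm.discriminant τ) =O[l] fun τ : ℍ => ‖(τ : ℂ)‖ := by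
        simpa using (h1.mul hΔ1).const_mul_left (-1728)
      exact t1.add hX
    have := (hΔb.mul t).const_mul_left 2
    exact this.congr (fun τ => by simp only [FjV24]; ring) (fun τ => by ring)
  · have := (hΔb.mul hX).neg_left
    exact this.congr (fun τ => by simp only [Ff24]) (fun τ => by ring)

/-- **Lemma 4.9 (4.15) for `𝒦₋^{(24)}|₁₂γ`, `γ ∈ {I, T, TS}`** (multiplied-out form): on `Im τ, Im z ≥ δ`,
`‖(𝒦₋^{(24)}|₁₂γ)(τ,Sz)z^{10}·Δ(τ)Δ(z)(j(τ)−j(z))‖ ≤ C|τ|²|z|²e^{−π Im τ}e^{−π Im z}`. [cite: CohnEtAl2019, Lemma 4.9 (4.15)] -/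
theorem kernelMinus24_S_bound_415 {δ : ℝ} (hδ : 0 < δ) (γ : SL(2, ℤ))
    (hγ : γ = 1 ∨ γ = ModularGroup.T ∨ γ = ModularGroup.T * ModularGroup.S) :
    ∃ C : ℝ, ∀ τ z : ℍ, δ ≤ τ.im → δ ≤ z.im →
      ‖((fun σ => kernelMinus24 σ (ModularGroup.S • z)) ∣[(12 : ℤ)] γ) τ * (z : ℂ) ^ 10 *
        (ModularForm.discriminant τ * ModularForm.discriminant z * (kleinJ τ - kleinJ z))‖
          ≤ C * (‖(τ : ℂ)‖ ^ 2 * ‖(z : ℂ)‖ ^ 2 * expDecayHalf τ * expDecayHalf z) := by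
  obtain ⟨hψ4, hψ2, hd, _, _, h4T, h4TS⟩ := halfPlane_isBigO_psi hδ
  obtain ⟨_, _, _, _, _, _, hx24, hx24S, hxi2, hxi4, hxi2S, hxi4S⟩ := halfPlane_isBigO_theta hδ
  obtain ⟨h4e, h6e, _, _, hE4, hE6, _, h1, hcoe, hq1⟩ := halfPlane_isBigO_basic hδ
  set l := 𝓟 (halfPlane δ)
  have hb0 : ∀ τ : ℍ, 0 ≤ expDecayHalf τ := fun τ => (expDecayHalf_pos τ).le
  -- weakenings
  have wk2 : (fun τ : ℍ => expDecayHalf τ ^ 2) =O[l] fun τ => expDecayHalf τ ^ 1 := by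
    rw [isBigO_principal]; exact ⟨1, fun τ _ => by
      rw [Real.norm_of_nonneg (pow_nonneg (hb0 τ) _), Real.norm_of_nonneg (pow_nonneg (hb0 τ) _), one_mul]
      exact pow_le_pow_of_le_one (hb0 τ) (expDecayHalf_le_one τ) (by norm_num)⟩
  have hqb : expDecay =O[l] fun τ => expDecayHalf τ ^ 1 := (wk2.congr_left fun τ => (expDecay_eq_sq τ).symm)
  have upτ : ∀ {f : ℍ → ℂ}, f =O[l] (fun τ => expDecayHalf τ ^ 1) → f =O[l] fun τ : ℍ => ‖(τ : ℂ)‖ * expDecayHalf τ ^ 1 := by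
    intro f hf; simpa using h1.mul hf
  -- `E₄ − E₆ = O(q)`
  have h46 : (fun τ : ℍ => E₄ τ - E₆ τ) =O[l] fun τ => expDecayHalf τ ^ 1 := ((h4e.sub h6e).congr_left fun τ => by ring).trans hqb
  -- rows `ψ`
  have dI : (fun τ => psi4 τ * E₄ τ - psi2 τ * E₆ τ) =O[l] fun τ : ℍ => ‖(τ : ℂ)‖ * expDecayHalf τ ^ 1 := by
    have t1 : (fun τ => (psi2 τ - psi4 τ) * E₄ τ) =O[l] fun τ : ℍ => ‖(τ : ℂ)‖ * expDecayHalf τ ^ 1 := by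
      have w : (fun τ => (psi2 τ - psi4 τ) * E₄ τ) =O[l] fun τ : ℍ => ‖(τ : ℂ)‖ * expDecayHalf τ ^ 2 := by simpa using hd.mul hE4
      exact w.trans ((isBigO_refl (fun τ : ℍ => ‖(τ : ℂ)‖) l).mul wk2 |>.congr_left fun τ => rfl)
    have t2 : (fun τ => psi2 τ * (E₄ τ - E₆ τ)) =O[l] fun τ : ℍ => ‖(τ : ℂ)‖ * expDecayHalf τ ^ 1 := hψ2.mul h46
    exact (t2.sub t1).congr_left fun τ => by ring
  -- extra rows `ξ`, `ξ|S`
  have dξ : (fun τ => xi4 τ * E₄ τ - xi2 τ * E₆ τ) =O[l] fun τ => expDecayHalf τ ^ 1 := by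
    have t1 : (fun τ => (xi2 τ - xi4 τ) * E₄ τ) =O[l] fun τ => expDecayHalf τ ^ 1 := by
      have := hx24.mul hE4; exact (this.congr_right fun τ => by ring).trans wk2
    have t2 : (fun τ => xi2 τ * (E₄ τ - E₆ τ)) =O[l] fun τ => expDecayHalf τ ^ 1 := by simpa using hxi2.mul h46
    exact (t2.sub t1).congr_left fun τ => by ring
  have dξS : (fun τ => xi4S τ * E₄ τ - xi2S τ * E₆ τ) =O[l] fun τ => expDecayHalf τ ^ 1 := by
    have t1 : (fun τ => (xi2S τ - xi4S τ) * E₄ τ) =O[l] fun τ => expDecayHalf τ ^ 1 := by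
      have := hx24S.mul hE4; exact this.congr_right fun τ => by ring
    have t2 : (fun τ => xi2S τ * (E₄ τ - E₆ τ)) =O[l] fun τ => expDecayHalf τ ^ 1 := by simpa using hxi2S.mul h46
    exact (t2.sub t1).congr_left fun τ => by ring
  have h2T : (psi2 + (π * I) • xi2) =O[l] fun τ : ℍ => ‖(τ : ℂ)‖ := by
    have hx : xi2 =O[l] fun τ : ℍ => ‖(τ : ℂ)‖ := by simpa using h1.mul hxi2
    exact (hψ2.add (hx.const_mul_left (π * I : ℂ))).congr_left fun τ => by simp [smul_eq_mul]
  have h2TS : (psi2 + (π * I) • xi2S) =O[l] fun τ : ℍ => ‖(τ : ℂ)‖ := by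
    have hx : xi2S =O[l] fun τ : ℍ => ‖(τ : ℂ)‖ := by simpa using h1.mul hxi2S
    exact (hψ2.add (hx.const_mul_left (π * I : ℂ))).congr_left fun τ => by simp [smul_eq_mul]
  have dT : (fun τ => (psi4 + (π * I) • xi4) τ * E₄ τ - (psi2 + (π * I) • xi2) τ * E₆ τ) =O[l]
      fun τ : ℍ => ‖(τ : ℂ)‖ * expDecayHalf τ ^ 1 := by
    have := dI.add (upτ (dξ.const_mul_left (π * I : ℂ)))
    exact this.congr_left fun τ => by simp only [Pi.add_apply, Pi.smul_apply, smul_eq_mul]; ring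
  have dTS : (fun τ => (psi4 + (π * I) • xi4S) τ * E₄ τ - (psi2 + (π * I) • xi2S) τ * E₆ τ) =O[l]
      fun τ : ℍ => ‖(τ : ℂ)‖ * expDecayHalf τ ^ 1 := by
    have := dI.add (upτ (dξS.const_mul_left (π * I : ℂ)))
    exact this.congr_left fun τ => by simp only [Pi.add_apply, Pi.smul_apply, smul_eq_mul]; ring
  have main : ∀ {R2 R4 : ℍ → ℂ}, psi2 ∣[(2 : ℤ)] γ = R2 → psi4 ∣[(4 : ℤ)] γ = R4 →
      R2 =O[l] (fun τ : ℍ => ‖(τ : ℂ)‖) → R4 =O[l] (fun τ : ℍ => ‖(τ : ℂ)‖) →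
      (fun τ => R4 τ * E₄ τ - R2 τ * E₆ τ) =O[l] (fun τ : ℍ => ‖(τ : ℂ)‖ * expDecayHalf τ ^ 1) →
      ∃ C : ℝ, ∀ τ z : ℍ, δ ≤ τ.im → δ ≤ z.im →
        ‖((fun σ => kernelMinus24 σ (ModularGroup.S • z)) ∣[(12 : ℤ)] γ) τ * (z : ℂ) ^ 10 *
          (ModularForm.discriminant τ * ModularForm.discriminant z * (kleinJ τ - kleinJ z))‖
            ≤ C * (‖(τ : ℂ)‖ ^ 2 * ‖(z : ℂ)‖ ^ 2 * expDecayHalf τ * expDecayHalf z) := by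
    intro R2 R4 e2 e4 hR2 hR4 hRd
    obtain ⟨fV, fjV, ff⟩ := minus24_F_isBigO_of_rows hδ hR2 hR4 hRd
    obtain ⟨C, hC⟩ := minus24Kernel_S_bound_of_isBigO hδ (minus24SBracket_isBigO hδ (by norm_num) fV fjV ff)
    refine ⟨C, fun τ z hτ hz => ?_⟩
    have := hC τ z hτ hz
    rw [kernelMinus24_eq_minus24Kernel, minus24Kernel_slash, e2, e4]
    rwa [pow_one] at this
  rcases hγ with rfl | rfl | rfl
  · exact main (by rw [SlashAction.slash_one]) (by rw [SlashAction.slash_one]) hψ2 hψ4 dI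
  · obtain ⟨⟨hT2, hT4⟩, _, _⟩ := psi_rows_slash
    exact main hT2 hT4 h2T h4T dT
  · obtain ⟨_, hS2, hS4⟩ := psi_rows_slash
    exact main hS2 hS4 h2TS h4TS dTS

/-! ## (4.17): fourth-order `τ`-expansions for the rows `ψ` -/

/-- `Λ(τ) = πiτ + log 16`. [cite: CohnEtAl2019, §2.1.2 (2.10)] -/
def lamLeadT (τ : ℍ) : ℂ := π * I * τ + (Real.log 16 : ℝ)

/-- **Uniform fourth-order expansions** on `Im τ ≥ δ` (`b = e^{πiτ}`):
`ξ₂ − 2 − 48b² , ξ₄ − 2 + 288b², (ξ₄E₄ − ξ₂E₆) − 1152b², (ξ₄|S·E₄ − ξ₂|S·E₆) − (72b − 576b² + 864b³) = O(b⁴)`,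
and **`ψ₄E₄ − ψ₂E₆ − 1152(Λ − 1)b² = O(|τ|b⁴)`**, `ψ₄ − 2Λ = O(|τ|b²)`.
[cite: CohnEtAl2019, §2.1.2, Lemma 4.9 (proof)] -/
theorem minus24_tau_expansions {δ : ℝ} (hδ : 0 < δ) :
    ((fun τ => xi2 τ - 2 - 48 * qhalf τ ^ 2) =O[𝓟 (halfPlane δ)] fun τ => expDecayHalf τ ^ 4) ∧
    ((fun τ => xi4 τ - 2 + 288 * qhalf τ ^ 2) =O[𝓟 (halfPlane δ)] fun τ => expDecayHalf τ ^ 4) ∧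
    ((fun τ => xi4 τ * E₄ τ - xi2 τ * E₆ τ - 1152 * qhalf τ ^ 2) =O[𝓟 (halfPlane δ)] fun τ => expDecayHalf τ ^ 4) ∧
    ((fun τ => xi4S τ * E₄ τ - xi2S τ * E₆ τ - (72 * qhalf τ - 576 * qhalf τ ^ 2 + 864 * qhalf τ ^ 3)) =O[𝓟 (halfPlane δ)]
        fun τ => expDecayHalf τ ^ 4) ∧
    ((fun τ => psi4 τ * E₄ τ - psi2 τ * E₆ τ - 1152 * (lamLeadT τ - 1) * qhalf τ ^ 2) =O[𝓟 (halfPlane δ)]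
        fun τ : ℍ => ‖(τ : ℂ)‖ * expDecayHalf τ ^ 4) ∧
    ((fun τ => psi4 τ - 2 * lamLeadT τ) =O[𝓟 (halfPlane δ)] fun τ : ℍ => ‖(τ : ℂ)‖ * expDecayHalf τ ^ 2) := by
  obtain ⟨⟨CU, hU⟩, ⟨CW, hW⟩, ⟨CV, hV⟩⟩ := thetaUVW_uniform hδ
  obtain ⟨⟨CS, hS⟩, ⟨CM, hM⟩⟩ := logLambda_uniform hδ
  obtain ⟨h2e, h4e, h6e, _, hq, he⟩ := halfPlane_heads hδ
  obtain ⟨hU1, hW1, hVb, _, hSb, hM1, _, _, hxi2, hxi4, hxi2S, hxi4S⟩ := halfPlane_isBigO_theta hδ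
  obtain ⟨_, _, _, _, hE4, hE6, _, h1, hcoe, _⟩ := halfPlane_isBigO_basic hδ
  set l := 𝓟 (halfPlane δ)
  have hb0 : ∀ τ : ℍ, 0 ≤ expDecayHalf τ := fun τ => (expDecayHalf_pos τ).le
  have mk : ∀ {f : ℍ → ℂ} (C : ℝ) (n : ℕ), (∀ τ : ℍ, δ ≤ τ.im → ‖f τ‖ ≤ C * expDecayHalf τ ^ n) →
      f =O[l] fun τ => expDecayHalf τ ^ n := by
    intro f C n h
    rw [isBigO_principal]
    exact ⟨C, fun τ hτ => by rw [Real.norm_of_nonneg (pow_nonneg (hb0 τ) n)]; exact h τ hτ⟩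
  have rU := mk CU 4 hU
  have rW := mk CW 4 hW
  have rV := mk CV 5 hV
  have rS := mk CS 3 hS
  have rM := mk CM 3 hM
  -- comparison functions
  have hb : qhalf =O[l] expDecayHalf := by
    rw [isBigO_principal]; exact ⟨1, fun τ _ => by rw [norm_qhalf, Real.norm_of_nonneg (hb0 τ), one_mul]⟩
  have hbp : ∀ n : ℕ, (fun τ => qhalf τ ^ n) =O[l] fun τ => expDecayHalf τ ^ n := fun n => hb.pow n
  have pw : ∀ {m n : ℕ}, n ≤ m → (fun τ => expDecayHalf τ ^ m) =O[l] fun τ => expDecayHalf τ ^ n := by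
    intro m n h
    rw [isBigO_principal]; exact ⟨1, fun τ _ => by
      rw [Real.norm_of_nonneg (pow_nonneg (hb0 τ) _), Real.norm_of_nonneg (pow_nonneg (hb0 τ) _), one_mul]
      exact pow_le_pow_of_le_one (hb0 τ) (expDecayHalf_le_one τ) h⟩
  have hbp1 : ∀ n : ℕ, (fun τ => qhalf τ ^ n) =O[l] fun _ : ℍ => (1 : ℝ) := fun n =>
    ((hbp n).trans (pw (Nat.zero_le n))).congr_right fun τ => pow_zero _
  have hb1 : qhalf =O[l] fun _ : ℍ => (1 : ℝ) := (hbp1 1).congr_left fun τ => pow_one _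
  have one1 : (fun _ : ℍ => (1 : ℂ)) =O[l] fun _ : ℍ => (1 : ℝ) := isBigO_const_const (1 : ℂ) (one_ne_zero : (1:ℝ) ≠ 0) _
  have hV1 : thetaV =O[l] fun _ : ℍ => (1 : ℝ) := hVb.trans ((pw (Nat.zero_le 1)).congr (fun τ => pow_one _) (fun τ => pow_zero _))
  -- `E`-heads in terms of `b² = q`
  have h4b : (fun τ : ℍ => E₄ τ - 1 - 240 * qhalf τ ^ 2) =O[l] fun τ => expDecayHalf τ ^ 4 :=
    h4e.congr (fun τ => by rw [qhalf_sq]) (fun τ => by rw [expDecay_eq_sq]; ring)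
  have h6b : (fun τ : ℍ => E₆ τ - 1 + 504 * qhalf τ ^ 2) =O[l] fun τ => expDecayHalf τ ^ 4 :=
    h6e.congr (fun τ => by rw [qhalf_sq]; ring) (fun τ => by rw [expDecay_eq_sq]; ring)
  -- polynomial tails
  have poly : ∀ (n : ℕ) (c : ℂ), 4 ≤ n → (fun τ => c * qhalf τ ^ n) =O[l] fun τ => expDecayHalf τ ^ 4 :=
    fun n c hn => ((hbp n).trans (pw hn)).const_mul_left c
  -- the theta polynomials
  set PU : ℍ → ℂ := fun τ => 1 + 8 * qhalf τ + 24 * qhalf τ ^ 2 + 32 * qhalf τ ^ 3 with hPU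
  set PW : ℍ → ℂ := fun τ => 1 - 8 * qhalf τ + 24 * qhalf τ ^ 2 - 32 * qhalf τ ^ 3 with hPW
  set PV : ℍ → ℂ := fun τ => 16 * qhalf τ + 64 * qhalf τ ^ 3 with hPV
  have dU : (fun τ => thetaU τ - PU τ) =O[l] fun τ => expDecayHalf τ ^ 4 := rU.congr_left fun τ => by simp only [hPU]; ring
  have dW : (fun τ => thetaW τ - PW τ) =O[l] fun τ => expDecayHalf τ ^ 4 := rW.congr_left fun τ => by simp only [hPW]; ring
  have dV : (fun τ => thetaV τ - PV τ) =O[l] fun τ => expDecayHalf τ ^ 5 := rV.congr_left fun τ => by simp only [hPV]; ring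
  have bPU : PU =O[l] fun _ : ℍ => (1 : ℝ) := by
    have := ((one1.add (hb1.const_mul_left 8)).add ((hbp1 2).const_mul_left 24)).add ((hbp1 3).const_mul_left 32)
    exact this.congr_left fun τ => by simp only [hPU]
  have bPW : PW =O[l] fun _ : ℍ => (1 : ℝ) := by
    have := ((one1.sub (hb1.const_mul_left 8)).add ((hbp1 2).const_mul_left 24)).sub ((hbp1 3).const_mul_left 32)
    exact this.congr_left fun τ => by simp only [hPW]
  have bPVb : PV =O[l] expDecayHalf := by
    have t : (fun τ => qhalf τ ^ 3) =O[l] expDecayHalf := ((hbp 3).trans (pw (by norm_num : 1 ≤ 3))).congr_right fun τ => pow_one _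
    have := (hb.const_mul_left 16).add (t.const_mul_left 64)
    exact this.congr_left fun τ => by simp only [hPV]
  have bPV : PV =O[l] fun _ : ℍ => (1 : ℝ) := bPVb.trans ((pw (Nat.zero_le 1)).congr (fun τ => pow_one _) (fun τ => pow_zero _))
  -- `ξ₂ − 2 − 48b²`
  have X2h : (fun τ => xi2 τ - 2 - 48 * qhalf τ ^ 2) =O[l] fun τ => expDecayHalf τ ^ 4 :=
    (dU.add dW).congr_left fun τ => by simp only [xi2, hPU, hPW, Pi.add_apply]; ring
  -- `ξ₄ − 2 + 288b²`
  have sqU : (fun τ => (thetaU τ - PU τ) * (thetaU τ + PU τ)) =O[l] fun τ => expDecayHalf τ ^ 4 := by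
    simpa using dU.mul (hU1.add bPU)
  have sqW : (fun τ => (thetaW τ - PW τ) * (thetaW τ + PW τ)) =O[l] fun τ => expDecayHalf τ ^ 4 := by
    simpa using dW.mul (hW1.add bPW)
  have sqV : (fun τ => (thetaV τ - PV τ) * (thetaV τ + PV τ)) =O[l] fun τ => expDecayHalf τ ^ 4 := by
    have := (dV.trans (pw (by norm_num : 4 ≤ 5))).mul (hV1.add bPV); simpa using this
  have X4h : (fun τ => xi4 τ - 2 + 288 * qhalf τ ^ 2) =O[l] fun τ => expDecayHalf τ ^ 4 := by
    have := ((sqU.add sqW).sub (sqV.const_mul_left 2)).add ((poly 4 (-1920) le_rfl).add (poly 6 (-6144) (by norm_num)))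
    refine this.congr_left fun τ => ?_
    simp only [xi4, hPU, hPW, hPV, Pi.add_apply, Pi.sub_apply, Pi.mul_apply, Pi.smul_apply, smul_eq_mul]
    ring
  -- `X1 − 1152b²`
  have bq2 : (fun τ : ℍ => 2 - 288 * qhalf τ ^ 2) =O[l] fun _ : ℍ => (1 : ℝ) := (one1.const_mul_left 2).sub ((hbp1 2).const_mul_left 288) |>.congr_left fun τ => by ring
  have bq2' : (fun τ : ℍ => 2 + 48 * qhalf τ ^ 2) =O[l] fun _ : ℍ => (1 : ℝ) := (one1.const_mul_left 2).add ((hbp1 2).const_mul_left 48) |>.congr_left fun τ => by ring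
  have X1h : (fun τ => xi4 τ * E₄ τ - xi2 τ * E₆ τ - 1152 * qhalf τ ^ 2) =O[l] fun τ => expDecayHalf τ ^ 4 := by
    have t1 : (fun τ => (xi4 τ - 2 + 288 * qhalf τ ^ 2) * E₄ τ) =O[l] fun τ => expDecayHalf τ ^ 4 := by simpa using X4h.mul hE4
    have t2 : (fun τ => (2 - 288 * qhalf τ ^ 2) * (E₄ τ - 1 - 240 * qhalf τ ^ 2)) =O[l] fun τ => expDecayHalf τ ^ 4 := by
      simpa using bq2.mul h4b
    have t3 : (fun τ => (xi2 τ - 2 - 48 * qhalf τ ^ 2) * E₆ τ) =O[l] fun τ => expDecayHalf τ ^ 4 := by simpa using X2h.mul hE6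
    have t4 : (fun τ => (2 + 48 * qhalf τ ^ 2) * (E₆ τ - 1 + 504 * qhalf τ ^ 2)) =O[l] fun τ => expDecayHalf τ ^ 4 := by
      simpa using bq2'.mul h6b
    have := (((t1.add t2).sub t3).sub t4).add (poly 4 (-44928) le_rfl)
    exact this.congr_left fun τ => by ring
  -- `X2 − (72b − 576b² + 864b³)`
  have X2Sh : (fun τ => xi4S τ * E₄ τ - xi2S τ * E₆ τ - (72 * qhalf τ - 576 * qhalf τ ^ 2 + 864 * qhalf τ ^ 3)) =O[l]
      fun τ => expDecayHalf τ ^ 4 := by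
    set AP : ℍ → ℂ := fun τ => -1 + 48 * qhalf τ + 144 * qhalf τ ^ 2 + 1344 * qhalf τ ^ 3 + 960 * qhalf τ ^ 4
      + 4608 * qhalf τ ^ 5 + 3072 * qhalf τ ^ 6 with hAP
    set BP : ℍ → ℂ := fun τ => 1 + 24 * qhalf τ + 24 * qhalf τ ^ 2 + 96 * qhalf τ ^ 3 with hBP
    have bAP : AP =O[l] fun _ : ℍ => (1 : ℝ) := by
      have := ((((((one1.neg_left).add (hb1.const_mul_left 48)).add ((hbp1 2).const_mul_left 144)).add ((hbp1 3).const_mul_left 1344)).add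
        ((hbp1 4).const_mul_left 960)).add ((hbp1 5).const_mul_left 4608)).add ((hbp1 6).const_mul_left 3072)
      exact this.congr_left fun τ => by simp only [hAP]
    have bBP : BP =O[l] fun _ : ℍ => (1 : ℝ) := by
      have := ((one1.add (hb1.const_mul_left 24)).add ((hbp1 2).const_mul_left 24)).add ((hbp1 3).const_mul_left 96)
      exact this.congr_left fun τ => by simp only [hBP]
    have t1 : (fun τ => ((thetaU τ - PU τ) * (thetaU τ + PU τ) + (thetaV τ - PV τ) * (thetaV τ + PV τ)
        - 2 * ((thetaW τ - PW τ) * (thetaW τ + PW τ))) * E₄ τ) =O[l] fun τ => expDecayHalf τ ^ 4 := by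
      simpa using ((sqU.add sqV).sub (sqW.const_mul_left 2)).mul hE4
    have t2 : (fun τ => AP τ * (E₄ τ - 1 - 240 * qhalf τ ^ 2)) =O[l] fun τ => expDecayHalf τ ^ 4 := by simpa using bAP.mul h4b
    have t3 : (fun τ => ((thetaU τ - PU τ) + (thetaV τ - PV τ)) * E₆ τ) =O[l] fun τ => expDecayHalf τ ^ 4 := by
      simpa using (dU.add (dV.trans (pw (by norm_num : 4 ≤ 5)))).mul hE6
    have t4 : (fun τ => BP τ * (E₆ τ - 1 + 504 * qhalf τ ^ 2)) =O[l] fun τ => expDecayHalf τ ^ 4 := by simpa using bBP.mul h6b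
    have t5 := ((((poly 4 23424 le_rfl).add (poly 5 278784 (by norm_num))).add (poly 6 233472 (by norm_num))).add
      (poly 7 1105920 (by norm_num))).add (poly 8 737280 (by norm_num))
    have := (((t1.add t2).add t3).add t4).add t5
    refine this.congr_left fun τ => ?_
    simp only [xi4S, xi2S, hPU, hPW, hPV, hAP, hBP, Pi.add_apply, Pi.sub_apply, Pi.mul_apply, Pi.neg_apply, Pi.smul_apply, smul_eq_mul]
    ring
  -- `𝓛 = Λ + M'`, `M' = logLambdaPer − log 16`
  have hL : ∀ τ : ℍ, logLambda τ = lamLeadT τ + (logLambdaPer τ - (Real.log 16 : ℝ)) := fun τ => by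
    simp only [logLambdaPer, lamLeadT]; ring
  have hM' : (fun τ => logLambdaPer τ - (Real.log 16 : ℝ) + 8 * qhalf τ) =O[l] fun τ => expDecayHalf τ ^ 2 := by
    have := (rM.trans (pw (by norm_num : 2 ≤ 3))).add ((hbp 2).const_mul_left 12)
    exact this.congr_left fun τ => by ring
  have hS3 : (fun τ => logLambdaS τ + 16 * qhalf τ) =O[l] fun τ => expDecayHalf τ ^ 3 := rS
  have hΛ : lamLeadT =O[l] fun τ : ℍ => ‖(τ : ℂ)‖ := by
    have t1 : (fun τ : ℍ => (π * I * τ : ℂ)) =O[l] fun τ : ℍ => ‖(τ : ℂ)‖ := by simpa using hcoe.const_mul_left (π * I : ℂ)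
    have t2 : (fun _ : ℍ => ((Real.log 16 : ℝ) : ℂ)) =O[l] fun τ : ℍ => ‖(τ : ℂ)‖ := by
      simpa using h1.const_mul_left (((Real.log 16 : ℝ)) : ℂ)
    exact (t1.add t2).congr_left fun τ => by simp [lamLeadT]
  have X1b : (fun τ => xi4 τ * E₄ τ - xi2 τ * E₆ τ) =O[l] fun τ => expDecayHalf τ ^ 2 := by
    have := (X1h.trans (pw (by norm_num : 2 ≤ 4))).add ((hbp 2).const_mul_left 1152)
    exact this.congr_left fun τ => by ring
  have X2b : (fun τ => xi4S τ * E₄ τ - xi2S τ * E₆ τ) =O[l] fun τ => expDecayHalf τ ^ 1 := by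
    have t : (fun τ => 72 * qhalf τ - 576 * qhalf τ ^ 2 + 864 * qhalf τ ^ 3) =O[l] fun τ => expDecayHalf τ ^ 1 :=
      (((hbp 1).const_mul_left 72 |>.congr_left fun τ => by ring).sub (((hbp 2).trans (pw (by norm_num : 1 ≤ 2))).const_mul_left 576)).add
        (((hbp 3).trans (pw (by norm_num : 1 ≤ 3))).const_mul_left 864)
    have := (X2Sh.trans (pw (by norm_num : 1 ≤ 4))).add t
    exact this.congr_left fun τ => by ring
  -- lift to `|τ|·`
  have upτ : ∀ {f : ℍ → ℂ} {k : ℕ}, f =O[l] (fun τ => expDecayHalf τ ^ k) → f =O[l] fun τ : ℍ => ‖(τ : ℂ)‖ * expDecayHalf τ ^ k := by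
    intro f k hf; simpa using h1.mul hf
  refine ⟨X2h, X4h, X1h, X2Sh, ?_, ?_⟩
  · -- `D = Λ(X1 − 1152b²) + (M'+8b)X1 − 8b(X1 − 1152b²) + (𝓛_S+16b)X2 − 16b(X2 − P₂) − 13824b⁴`
    have t1 : (fun τ => lamLeadT τ * (xi4 τ * E₄ τ - xi2 τ * E₆ τ - 1152 * qhalf τ ^ 2)) =O[l]
        fun τ : ℍ => ‖(τ : ℂ)‖ * expDecayHalf τ ^ 4 := hΛ.mul X1h
    have t2 : (fun τ => (logLambdaPer τ - (Real.log 16 : ℝ) + 8 * qhalf τ) * (xi4 τ * E₄ τ - xi2 τ * E₆ τ)) =O[l]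
        fun τ => expDecayHalf τ ^ 4 := (hM'.mul X1b).congr_right fun τ => by ring
    have t3 : (fun τ => 8 * qhalf τ * (xi4 τ * E₄ τ - xi2 τ * E₆ τ - 1152 * qhalf τ ^ 2)) =O[l] fun τ => expDecayHalf τ ^ 4 := by
      have := (hb1.mul X1h).const_mul_left 8
      exact this.congr (fun τ => by ring) (fun τ => by ring)
    have t4 : (fun τ => (logLambdaS τ + 16 * qhalf τ) * (xi4S τ * E₄ τ - xi2S τ * E₆ τ)) =O[l] fun τ => expDecayHalf τ ^ 4 :=
      (hS3.mul X2b).congr_right fun τ => by ring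
    have t5 : (fun τ => 16 * qhalf τ * (xi4S τ * E₄ τ - xi2S τ * E₆ τ - (72 * qhalf τ - 576 * qhalf τ ^ 2 + 864 * qhalf τ ^ 3))) =O[l]
        fun τ => expDecayHalf τ ^ 4 := by
      have := (hb1.mul X2Sh).const_mul_left 16
      exact this.congr (fun τ => by ring) (fun τ => by ring)
    have := ((((t1.add (upτ t2)).sub (upτ t3)).add (upτ t4)).sub (upτ t5)).sub (upτ (poly 4 13824 le_rfl))
    refine this.congr_left fun τ => ?_
    simp only [psi2, psi4, Pi.add_apply, Pi.mul_apply, hL τ]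
    ring
  · -- `ψ₄ − 2Λ = (ξ₄ − 2)𝓛 + 2(M' + 8b) − (𝓛_S + 16b) + (ξ₄|S + 1)𝓛_S`
    have hx42 : (fun τ => xi4 τ - 2) =O[l] fun τ => expDecayHalf τ ^ 2 := by
      have := (X4h.trans (pw (by norm_num : 2 ≤ 4))).sub ((hbp 2).const_mul_left 288)
      exact this.congr_left fun τ => by ring
    have hLb : logLambda =O[l] fun τ : ℍ => ‖(τ : ℂ)‖ := by
      have t2 : logLambdaPer =O[l] fun τ : ℍ => ‖(τ : ℂ)‖ := by simpa using h1.mul hM1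
      have t1 : (fun τ : ℍ => (π * I * τ : ℂ)) =O[l] fun τ : ℍ => ‖(τ : ℂ)‖ := by simpa using hcoe.const_mul_left (π * I : ℂ)
      exact (t1.add t2).congr_left fun τ => by simp [logLambdaPer]
    have hx4S1 : (fun τ => xi4S τ + 1) =O[l] fun τ => expDecayHalf τ ^ 1 := by
      -- `ξ₄|S + 1 = (U−1)(U+1) + V² − 2(W−1)(W+1)`
      have hu : (fun τ => thetaU τ - 1) =O[l] fun τ => expDecayHalf τ ^ 1 := by
        have := (dU.trans (pw (by norm_num : 1 ≤ 4))).add ((((hbp 1).const_mul_left 8).add (((hbp 2).trans (pw (by norm_num : 1 ≤ 2))).const_mul_left 24)).add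
          (((hbp 3).trans (pw (by norm_num : 1 ≤ 3))).const_mul_left 32))
        exact this.congr_left fun τ => by simp only [hPU]; ring
      have hw : (fun τ => thetaW τ - 1) =O[l] fun τ => expDecayHalf τ ^ 1 := by
        have := (dW.trans (pw (by norm_num : 1 ≤ 4))).add ((((hbp 1).const_mul_left (-8)).add (((hbp 2).trans (pw (by norm_num : 1 ≤ 2))).const_mul_left 24)).add
          (((hbp 3).trans (pw (by norm_num : 1 ≤ 3))).const_mul_left (-32)))
        exact this.congr_left fun τ => by simp only [hPW]; ring
      have t1 : (fun τ => (thetaU τ - 1) * (thetaU τ + 1)) =O[l] fun τ => expDecayHalf τ ^ 1 := by simpa using hu.mul (hU1.add one1)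
      have t2 : (fun τ => thetaV τ * thetaV τ) =O[l] fun τ => expDecayHalf τ ^ 1 := by
        have := hV1.mul hVb; exact this.congr_right fun τ => by ring
      have t3 : (fun τ => (thetaW τ - 1) * (thetaW τ + 1)) =O[l] fun τ => expDecayHalf τ ^ 1 := by simpa using hw.mul (hW1.add one1)
      have := (t1.add t2).sub (t3.const_mul_left 2)
      exact this.congr_left fun τ => by
        simp only [xi4S, Pi.add_apply, Pi.sub_apply, Pi.mul_apply, Pi.smul_apply, smul_eq_mul]; ring
    have t1 : (fun τ => (xi4 τ - 2) * logLambda τ) =O[l] fun τ : ℍ => ‖(τ : ℂ)‖ * expDecayHalf τ ^ 2 :=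
      (hx42.mul hLb).congr_right fun τ => by ring
    have t2 : (fun τ => 2 * (logLambdaPer τ - (Real.log 16 : ℝ) + 8 * qhalf τ)) =O[l] fun τ => expDecayHalf τ ^ 2 := hM'.const_mul_left 2
    have t3 : (fun τ => logLambdaS τ + 16 * qhalf τ) =O[l] fun τ => expDecayHalf τ ^ 2 := hS3.trans (pw (by norm_num : 2 ≤ 3))
    have t4 : (fun τ => (xi4S τ + 1) * logLambdaS τ) =O[l] fun τ => expDecayHalf τ ^ 2 := by
      have := hx4S1.mul hSb; exact this.congr_right fun τ => by ring
    have := ((t1.add (upτ t2)).sub (upτ t3)).add (upτ t4)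
    refine this.congr_left fun τ => ?_
    simp only [psi4, Pi.add_apply, Pi.mul_apply, hL τ]
    ring

/-- For the rows `ψ`: `F_V, F_{jV}, F_f = O(|τ|e^{−4π Im τ})` on half-planes. [cite: CohnEtAl2019, Lemma 4.9 (4.17)] -/
theorem minus24_F_psi_isBigO {δ : ℝ} (hδ : 0 < δ) :
    (FV24 psi2 psi4 =O[𝓟 (halfPlane δ)] fun τ : ℍ => ‖(τ : ℂ)‖ * expDecayHalf τ ^ 4) ∧
    (FjV24 psi2 psi4 =O[𝓟 (halfPlane δ)] fun τ : ℍ => ‖(τ : ℂ)‖ * expDecayHalf τ ^ 4) ∧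
    (Ff24 psi2 psi4 =O[𝓟 (halfPlane δ)] fun τ : ℍ => ‖(τ : ℂ)‖ * expDecayHalf τ ^ 4) := by
  obtain ⟨_, _, _, _, hD, hψΛ⟩ := minus24_tau_expansions hδ
  obtain ⟨hψ4, hψ2, hd, _, _, _, _⟩ := halfPlane_isBigO_psi hδ
  obtain ⟨h2e, h4e, h6e, hDq, hq, he⟩ := halfPlane_heads hδ
  obtain ⟨h4m, h6m, _, hΔ, hE4, hE6, _, h1, hcoe, hq1⟩ := halfPlane_isBigO_basic hδ
  set l := 𝓟 (halfPlane δ)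
  have hb0 : ∀ τ : ℍ, 0 ≤ expDecayHalf τ := fun τ => (expDecayHalf_pos τ).le
  have bb : ∀ {u v : ℍ → ℂ}, u =O[l] (fun _ : ℍ => (1 : ℝ)) → v =O[l] (fun _ : ℍ => (1 : ℝ)) →
      (fun τ => u τ * v τ) =O[l] fun _ : ℍ => (1 : ℝ) := fun hu hv => by simpa using hu.mul hv
  have hE4_2 : (fun τ : ℍ => E₄ τ ^ 2) =O[l] fun _ : ℍ => (1 : ℝ) := by simpa [sq] using bb hE4 hE4
  have hE4_4 : (fun τ : ℍ => E₄ τ ^ 4) =O[l] fun _ : ℍ => (1 : ℝ) := by simpa [← pow_add] using bb hE4_2 hE4_2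
  -- `Δ = O(b²)`, `q = b²`
  have hΔ2 : (ModularForm.discriminant : ℍ → ℂ) =O[l] fun τ => expDecayHalf τ ^ 2 := hΔ.congr_right fun τ => expDecay_eq_sq τ
  have e4 : ∀ τ : ℍ, expDecay τ ^ 2 = expDecayHalf τ ^ 4 := fun τ => by rw [expDecay_eq_sq]; ring
  -- `E₄²q − Δ = (E₄² − 1)q − (Δ − q) = O(b⁴)`
  have hE2q : (fun τ : ℍ => E₄ τ ^ 2 * qfun τ - ModularForm.discriminant τ) =O[l] fun τ => expDecayHalf τ ^ 4 := by
    have t1 : (fun τ : ℍ => (E₄ τ - 1) * (E₄ τ + 1) * qfun τ) =O[l] fun τ => expDecayHalf τ ^ 4 := by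
      have := (h4m.mul (hE4.add (isBigO_const_const (1 : ℂ) (one_ne_zero : (1:ℝ) ≠ 0) _))).mul hq
      exact this.congr_right fun τ => by rw [expDecay_eq_sq]; ring
    have t2 : (fun τ : ℍ => ModularForm.discriminant τ - qfun τ) =O[l] fun τ => expDecayHalf τ ^ 4 := hDq.congr_right fun τ => e4 τ
    exact (t1.sub t2).congr_left fun τ => by ring
  have hΛ1 : (fun τ => lamLeadT τ - 1) =O[l] fun τ : ℍ => ‖(τ : ℂ)‖ := by
    have t1 : (fun τ : ℍ => (π * I * τ : ℂ)) =O[l] fun τ : ℍ => ‖(τ : ℂ)‖ := by simpa using hcoe.const_mul_left (π * I : ℂ)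
    have t2 : (fun _ : ℍ => ((Real.log 16 : ℝ) : ℂ) - 1) =O[l] fun τ : ℍ => ‖(τ : ℂ)‖ := by
      simpa using h1.const_mul_left (((Real.log 16 : ℝ)) - 1 : ℂ)
    exact (t1.add t2).congr_left fun τ => by simp only [lamLeadT]; ring
  -- `X = ψ₂E₁₀ − ψ₄E₈ = (ψ₂ − ψ₄)E₁₀ + ψ₄E₄(E₆ − E₄) = O(|τ|b²)`
  have hX : (fun τ => psi2 τ * E10fun τ - psi4 τ * E8fun τ) =O[l] fun τ : ℍ => ‖(τ : ℂ)‖ * expDecayHalf τ ^ 2 := by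
    have t1 : (fun τ => (psi2 τ - psi4 τ) * E10fun τ) =O[l] fun τ : ℍ => ‖(τ : ℂ)‖ * expDecayHalf τ ^ 2 := by
      simpa using hd.mul ((bb hE4 hE6).congr_left fun τ => by simp [E10fun])
    have h64 : (fun τ : ℍ => E₆ τ - E₄ τ) =O[l] fun τ => expDecayHalf τ ^ 2 :=
      ((h6m.sub h4m).congr_left fun τ => by ring).congr_right fun τ => expDecay_eq_sq τ
    have t2 : (fun τ => psi4 τ * E₄ τ * (E₆ τ - E₄ τ)) =O[l] fun τ : ℍ => ‖(τ : ℂ)‖ * expDecayHalf τ ^ 2 := by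
      have := (hψ4.mul hE4).mul h64; simpa using this
    exact (t1.add t2).congr_left fun τ => by simp only [E10fun, E8fun, Pi.mul_apply]; ring
  have hXb : (fun τ => -1728 * ModularForm.discriminant τ + (psi2 τ * E10fun τ - psi4 τ * E8fun τ)) =O[l]
      fun τ : ℍ => ‖(τ : ℂ)‖ * expDecayHalf τ ^ 2 := by
    have t1 : (fun τ : ℍ => -1728 * ModularForm.discriminant τ) =O[l] fun τ : ℍ => ‖(τ : ℂ)‖ * expDecayHalf τ ^ 2 := by
      simpa using (h1.mul hΔ2).const_mul_left (-1728)
    exact t1.add hX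
  refine ⟨?_, ?_, ?_⟩
  · -- `F_V = 3E₄⁴D + 3456(Λ−1)E₄²(E₄²q − Δ) + 3456ΔE₄²(E₄ − 1) − 1728ΔE₄²(ψ₄ − 2Λ)`
    have t1 : (fun τ => 3 * E₄ τ ^ 4 * (psi4 τ * E₄ τ - psi2 τ * E₆ τ - 1152 * (lamLeadT τ - 1) * qhalf τ ^ 2)) =O[l]
        fun τ : ℍ => ‖(τ : ℂ)‖ * expDecayHalf τ ^ 4 := by
      have := (hE4_4.mul hD).const_mul_left 3
      exact this.congr (fun τ => by ring) (fun τ => by ring)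
    have t2 : (fun τ => 3456 * (lamLeadT τ - 1) * E₄ τ ^ 2 * (E₄ τ ^ 2 * qfun τ - ModularForm.discriminant τ)) =O[l]
        fun τ : ℍ => ‖(τ : ℂ)‖ * expDecayHalf τ ^ 4 := by
      have := ((hΛ1.mul hE4_2).mul hE2q).const_mul_left 3456
      exact this.congr (fun τ => by ring) (fun τ => by ring)
    have t3 : (fun τ => 3456 * ModularForm.discriminant τ * E₄ τ ^ 2 * (E₄ τ - 1)) =O[l] fun τ : ℍ => ‖(τ : ℂ)‖ * expDecayHalf τ ^ 4 := by
      have h4b : (fun τ : ℍ => E₄ τ - 1) =O[l] fun τ => expDecayHalf τ ^ 2 := h4m.congr_right fun τ => expDecay_eq_sq τ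
      have := (h1.mul ((hΔ2.mul hE4_2).mul h4b)).const_mul_left 3456
      exact this.congr (fun τ => by ring) (fun τ => by ring)
    have t4 : (fun τ => 1728 * ModularForm.discriminant τ * E₄ τ ^ 2 * (psi4 τ - 2 * lamLeadT τ)) =O[l]
        fun τ : ℍ => ‖(τ : ℂ)‖ * expDecayHalf τ ^ 4 := by
      have := ((hΔ2.mul hE4_2).mul hψΛ).const_mul_left 1728
      exact this.congr (fun τ => by ring) (fun τ => by ring)
    have := ((t1.add t2).add t3).sub t4
    refine this.congr_left fun τ => ?_
    rw [FV24_eq]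
    have hq2 := qhalf_sq τ
    rw [← hq2]
    ring
  · have := (hΔ2.mul hXb).const_mul_left 2
    exact this.congr (fun τ => by simp only [FjV24]; ring) (fun τ => by ring)
  · have := (hΔ2.mul hX).neg_left
    exact this.congr (fun τ => by simp only [Ff24]) (fun τ => by ring)

/-- **Lemma 4.9 (4.17) for `𝒦₋^{(24)}`** (multiplied-out form): on `Im τ, Im z ≥ δ`,
`‖𝒦₋^{(24)}(τ,Sz)z^{10}·Δ(τ)Δ(z)(j(τ)−j(z))‖ ≤ C|τ|²|z|²e^{−4π Im τ}e^{−π Im z}`. [cite: CohnEtAl2019, Lemma 4.9 (4.17)] -/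
theorem kernelMinus24_S_bound_417 {δ : ℝ} (hδ : 0 < δ) : ∃ C : ℝ, ∀ τ z : ℍ, δ ≤ τ.im → δ ≤ z.im →
    ‖kernelMinus24 τ (ModularGroup.S • z) * (z : ℂ) ^ 10 *
      (ModularForm.discriminant τ * ModularForm.discriminant z * (kleinJ τ - kleinJ z))‖
        ≤ C * (‖(τ : ℂ)‖ ^ 2 * ‖(z : ℂ)‖ ^ 2 * expDecay τ ^ 2 * expDecayHalf z) := by
  obtain ⟨fV, fjV, ff⟩ := minus24_F_psi_isBigO hδ
  obtain ⟨C, hC⟩ := minus24Kernel_S_bound_of_isBigO hδ (minus24SBracket_isBigO hδ le_rfl fV fjV ff)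
  refine ⟨C, fun τ z hτ hz => ?_⟩
  have := hC τ z hτ hz
  rw [kernelMinus24_eq_minus24Kernel]
  rwa [show expDecay τ ^ 2 = expDecayHalf τ ^ 4 by rw [expDecay_eq_sq]; ring]

end Literature.NumberTheory.ModularForms
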